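import Mathlib

/-!
# Route BarrierLever — item `PartitionMinorsHitByVP` (stmt-ValiantsHypothesis-19717):
# one PASS of down-compressions of a `Fin r`-indexed set family yields a simplicial complex

Helper file (`--supports stmt-ValiantsHypothesis-19717`; cell valiant-natproofs, rung V4, 𝒟-side
door (c); prover seat val-np-p1 gen 12). Mathlib only, definition-free. Closes NO item. Companion
of `…PartitionMinorsHitByVPDownCompression` (the algebraic step) and
`…PartitionMinorsHitByVPOfLowerSets` (the reduction of item 19717 to lower-set layouts).

Families are maps `u : Fin r → Finset (Fin h)` (the item's indexing). «`v` is the DOWN-COMPRESSION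
`𝓓_a u`» is the pair of hypotheses `hv₁ / hv₂` (a row `u i ∋ a` whose shadow `u i ∖ a` is not a row
is replaced by its shadow; every other row is kept), «`u` is `a`-compressed» is
`∀ i, a ∈ u i → ∃ k, u k = (u i).erase a` — both spelled out, no definition introduced.

* `injective_of_compOf` — compression preserves injectivity;
* `isComp_of_compOf` — `𝓓_a u` is `a`-compressed;
* `isComp_of_compOf_of_isComp` — **one pass suffices**: `𝓓_b` preserves `a`-compressedness
  (the classical fact behind Kleitman/Frankl down-shifting);
* `isLowerSet_range_of_isComp` — a family compressed in every coordinate has a LOWER-SET range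
  (is a simplicial complex).

WHAT THIS IS NOT: set-family bookkeeping; nothing on item 19717 itself, on crux
stmt-ValiantsHypothesis-14610, or on `VP` versus `VNP`.
-/

set_option linter.dupNamespace false

namespace Summit.ValiantsHypothesis.ValiantsHypothesis.Theorems.BarrierLever.DownCompression

variable {h r : ℕ}

/-! ## Combinatorics of one compression pass (families indexed by `Fin r`) -/

/-- The `a`-compression of an injective family is injective. -/
theorem injective_of_compOf (u v : Fin r → Finset (Fin h)) (a : Fin h) (hu : Function.Injective u)
    (hv₁ : ∀ i, a ∈ u i → (∀ k, u k ≠ (u i).erase a) → v i = (u i).erase a)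
    (hv₂ : ∀ i, ¬ (a ∈ u i ∧ ∀ k, u k ≠ (u i).erase a) → v i = u i) :
    Function.Injective v := by
  intro i j hij
  by_cases hi : a ∈ u i ∧ ∀ k, u k ≠ (u i).erase a <;>
    by_cases hj : a ∈ u j ∧ ∀ k, u k ≠ (u j).erase a
  · rw [hv₁ i hi.1 hi.2, hv₁ j hj.1 hj.2] at hij
    exact hu (by rw [← Finset.insert_erase hi.1, ← Finset.insert_erase hj.1, hij])
  · rw [hv₁ i hi.1 hi.2, hv₂ j hj] at hij
    exact absurd hij.symm (hi.2 j)
  · rw [hv₂ i hi, hv₁ j hj.1 hj.2] at hij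
    exact absurd hij (hj.2 i)
  · rw [hv₂ i hi, hv₂ j hj] at hij
    exact hu hij

/-- The `a`-compression of a family is `a`-compressed. -/
theorem isComp_of_compOf (u v : Fin r → Finset (Fin h)) (a : Fin h)
    (hv₁ : ∀ i, a ∈ u i → (∀ k, u k ≠ (u i).erase a) → v i = (u i).erase a)
    (hv₂ : ∀ i, ¬ (a ∈ u i ∧ ∀ k, u k ≠ (u i).erase a) → v i = u i) :
    ∀ i, a ∈ v i → ∃ k, v k = (v i).erase a := by
  intro i hai
  by_cases hi : a ∈ u i ∧ ∀ k, u k ≠ (u i).erase a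
  · rw [hv₁ i hi.1 hi.2] at hai
    exact absurd hai (Finset.notMem_erase a _)
  · rw [hv₂ i hi] at hai ⊢
    have hk : ∃ k, u k = (u i).erase a := by
      by_contra hne
      push Not at hne
      exact hi ⟨hai, hne⟩
    obtain ⟨k, hk⟩ := hk
    refine ⟨k, ?_⟩
    rw [hv₂ k (fun hk' => ?_), hk]
    rw [hk] at hk'
    exact Finset.notMem_erase a _ hk'.1

/-- **One pass suffices**: the `b`-compression of an `a`-compressed family is `a`-compressed. -/
theorem isComp_of_compOf_of_isComp (u v : Fin r → Finset (Fin h)) (a b : Fin h)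
    (hua : ∀ i, a ∈ u i → ∃ k, u k = (u i).erase a)
    (hv₁ : ∀ i, b ∈ u i → (∀ k, u k ≠ (u i).erase b) → v i = (u i).erase b)
    (hv₂ : ∀ i, ¬ (b ∈ u i ∧ ∀ k, u k ≠ (u i).erase b) → v i = u i) :
    ∀ i, a ∈ v i → ∃ k, v k = (v i).erase a := by
  intro i hai
  -- a row `k'` whose set avoids `b` is never moved
  have hfix : ∀ k', b ∉ u k' → v k' = u k' := fun k' hb => hv₂ k' (fun h' => hb h'.1)
  by_cases hi : b ∈ u i ∧ ∀ k, u k ≠ (u i).erase b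
  · -- row `i` is moved: `v i = u i ∖ b`
    rw [hv₁ i hi.1 hi.2] at hai ⊢
    have hab : a ≠ b := by rintro rfl; exact Finset.notMem_erase a _ hai
    have haU : a ∈ u i := Finset.mem_of_mem_erase hai
    obtain ⟨k, hk⟩ := hua i haU
    have hbk : b ∈ u k := by rw [hk]; exact Finset.mem_erase.mpr ⟨hab.symm, hi.1⟩
    by_cases hkm : ∀ k3, u k3 ≠ (u k).erase b
    · refine ⟨k, ?_⟩
      rw [hv₁ k hbk hkm, hk, Finset.erase_right_comm]
    · push Not at hkm
      obtain ⟨k3, hk3⟩ := hkm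
      refine ⟨k3, ?_⟩
      rw [hfix k3 (by rw [hk3]; exact Finset.notMem_erase b _), hk3, hk, Finset.erase_right_comm]
  · -- row `i` is not moved: `v i = u i`
    rw [hv₂ i hi] at hai ⊢
    obtain ⟨k, hk⟩ := hua i hai
    by_cases hkm : b ∈ u k ∧ ∀ k3, u k3 ≠ (u k).erase b
    · -- the shadow row `k` was moved: impossible
      exfalso
      have hbU : b ∈ u i := by
        have := hkm.1; rw [hk] at this; exact Finset.mem_of_mem_erase this
      have hab : a ≠ b := by
        rintro rfl; have := hkm.1; rw [hk] at this; exact Finset.notMem_erase a _ this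
      -- `i` not moved and `b ∈ u i`: its `b`-shadow is a row `k''`
      have hk'' : ∃ k'', u k'' = (u i).erase b := by
        by_contra hne; push Not at hne; exact hi ⟨hbU, hne⟩
      obtain ⟨k'', hk''⟩ := hk''
      have hak'' : a ∈ u k'' := by rw [hk'']; exact Finset.mem_erase.mpr ⟨hab, hai⟩
      obtain ⟨k3, hk3⟩ := hua k'' hak''
      apply hkm.2 k3
      rw [hk3, hk'', hk, Finset.erase_right_comm]
    · exact ⟨k, by rw [hv₂ k hkm, hk]⟩

/-- A family compressed in every coordinate has a lower-set range (a simplicial complex). -/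
theorem isLowerSet_range_of_isComp (u : Fin r → Finset (Fin h))
    (hu : ∀ (a : Fin h) (i : Fin r), a ∈ u i → ∃ k, u k = (u i).erase a) :
    IsLowerSet (Set.range u) := by
  -- remove the elements of `S \ T` one at a time
  have key : ∀ (n : ℕ) (S T : Finset (Fin h)), T ⊆ S → (S \ T).card = n →
      S ∈ Set.range u → T ∈ Set.range u := by
    intro n
    induction n with
    | zero =>
      intro S T hTS hcard hS
      have hST : S \ T = ∅ := Finset.card_eq_zero.mp hcard
      rw [Finset.sdiff_eq_empty_iff_subset] at hST
      rwa [Finset.Subset.antisymm hTS hST]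
    | succ n ih =>
      intro S T hTS hcard hS
      obtain ⟨a, ha⟩ : (S \ T).Nonempty := Finset.card_pos.mp (by omega)
      obtain ⟨i, hi⟩ := hS
      rw [Finset.mem_sdiff] at ha
      obtain ⟨k, hk⟩ := hu a i (hi ▸ ha.1)
      refine ih (S.erase a) T ?_ ?_ ⟨k, by rw [hk, hi]⟩
      · intro x hx
        exact Finset.mem_erase.mpr ⟨fun hxa => ha.2 (hxa ▸ hx), hTS hx⟩
      · rw [Finset.erase_sdiff_comm, Finset.card_erase_of_mem (Finset.mem_sdiff.mpr ha), hcard]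
        rfl
  intro S T hTS hS
  exact key _ S T hTS rfl hS

end Summit.ValiantsHypothesis.ValiantsHypothesis.Theorems.BarrierLever.DownCompression
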